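import Literature.NumberTheory.GelbartRogawski1991.Prop311AsPrinted
import Literature.LinearAlgebra.Alternating.DarbouxBasisBaseChange
import Literature.RepresentationTheory.HeisenbergGroup.HeisenbergCoboundary
import Literature.NumberTheory.Automorphic.AdelicGLnGlue
import Literature.NumberTheory.Automorphic.FiniteAdeleSchwartzBruhatFourier
import HarnessLib

/-!
# [GelbartRogawski1991, §3.1]: adelic Darboux coordinates for `H_𝐀(W)` and its archimedean / finite-adelic parts

Topic `NumberTheory/GelbartRogawski1991`; namespace `Literature.NumberTheory.GelbartRogawski1991.Prop311` (the
namespace of the auxiliary objects of the statement-exact typing `Prop311AsPrinted`).  KERNEL ONLY: theorems; no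
definition, no named fact, no `sorry`; `Prop311AsPrinted` itself is untouched.

[GelbartRogawski1991, §3.1 p. 454 L17–21]: "*Let `(W, φ)` be a symplectic space over `F` and let `H(W) = W ⊕ F`
be the associated Heisenberg group. … For each non-trivial character `ψ`, let `ρ_ψ` be an irreducible unitary
representation of `H_𝐀(W)` with central character `ψ` (`ρ_ψ` is unique up to isomorphism).*"  The uniqueness is
proved in the tree for the SHAPE `H(W_∞) · H(W_fin)` (`HeisenbergGroup/HeisenbergPairUniqueness`,
`AdelicShapeUniqueness`).  This file supplies the COORDINATES identifying the printed `H_𝐀(W)` — the tree's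
`Prop311.AdelicHeisenberg F E V Φ = Heisenberg (heisForm F E V Φ)` on `W_𝐀 = 𝐀 ⊗_F V`, `heisForm = ½ φ_𝐀`,
`𝐀 = AdeleRing (𝓞 F) F = F_∞ × 𝐀_F^∞` (Mathlib's definition) — with that shape:

* §1 `exists_adelicDarboux`: `𝐀`-linear Darboux coordinates `e : 𝐀ⁿ × 𝐀ⁿ ≃ W_𝐀` with
  `φ_𝐀(e(x,y), e(x',y')) = x·y' − x'·y` (`LinearAlgebra/Alternating/DarbouxBasisBaseChange`), hence
  `heisForm(e c, e c') = ½ (x·y' − x'·y)` (`heisForm_coord`);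
* §2 the ARCHIMEDEAN coordinates `J_∞ : (ℝ^{r₁} × ℂ^{r₂})ⁿ × (…)ⁿ → 𝐀ⁿ × 𝐀ⁿ`, `(x, y) ↦ (2 (x_i, 0)_i, (y_i, 0)_i)`
  (through `InfiniteAdeleRing.ringEquiv_mixedSpace` and `infiniteAdeleInl`): `heisForm` restricts to the standard
  alternating form `altPolar` of the dot product, pushed forward by `x ↦ (x, 0)` (`heisForm_coord_arch`);
* §3 the FINITE-ADELIC coordinates `J_f : (𝐀_F^∞)ⁿ × (𝐀_F^∞)ⁿ → 𝐀ⁿ × 𝐀ⁿ`, `(x, y) ↦ ((0, x_i)_i, (0, y_i)_i)`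
  (`finiteAdeleInr`): `heisForm` restricts to `½ altPolar`, pushed forward by `t ↦ (0, t)` (`heisForm_coord_fin`);
* §4 the two parts are `heisForm`-orthogonal (`heisForm_coord_arch_fin`, `heisForm_coord_fin_arch`) and together
  exhaust `𝐀ⁿ × 𝐀ⁿ` and `𝐀` (`exists_eq_archCoord_add_finCoord`, `exists_eq_inl_add_inr`);
* §5 continuity: `e` for the module topology of `W_𝐀` (rendering R8 of `Prop311AsPrinted`), `J_∞`, `J_f`
  (`continuous_coord`, `continuous_archCoord`, `continuous_finCoord`).

These are exactly the inputs `hjk₁`, `hjk₂`, `h₁₂`, `h₂₁`, `hV`, `hR` of `HeisenbergGroup/HeisenbergTwoFactors`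
(`Heisenberg.map_mul_map_comm`, `Heisenberg.exists_eq_map_mul_map`) for the printed `H_𝐀(W)`.

## References
* [GelbartRogawski1991] S. Gelbart, J. Rogawski, Invent. Math. 105 (1991), §3.1 p. 454 L17–22, L40–42.
* [Weil1964] A. Weil, Acta Math. 111 (1964), Chap. I n° 3–4, Chap. III n° 37 (adelic `A(X)` as a restricted product).
-/

set_option autoImplicit false

noncomputable section

open NumberField IsDedekindDomain NumberField.mixedEmbedding InfiniteAdeleRing
open Literature.RepresentationTheory.HeisenbergGroup Literature.NumberTheory.Automorphic
open Literature.LinearAlgebra.Alternating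
open scoped TensorProduct

namespace Literature.NumberTheory.GelbartRogawski1991

namespace Prop311

variable {F : Type} [Field F] [NumberField F]
variable {E : Type} [Field E] [Algebra F E]
variable {V : Type} [AddCommGroup V] [Module F V]
variable {Φ : V →ₗ[F] V →ₗ[F] E}

/-! ## §1 Adelic Darboux coordinates -/

variable (F E V Φ) in
/-- **adelic Darboux coordinates**: for `φ = Tr_{E/F} Φ` alternating and non-degenerate there are `n` and an
`𝐀`-linear `e : 𝐀ⁿ × 𝐀ⁿ ≃ W_𝐀 = 𝐀 ⊗_F V` with `φ_𝐀(e(x, y), e(x', y')) = x · y' − x' · y`.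
[cite: GelbartRogawski1991, §3.1 p. 454 L17–22, L40–42] -/
theorem exists_adelicDarboux [FiniteDimensional F V] (hφa : (traceForm F E V Φ).IsAlt)
    (hφ : (traceForm F E V Φ).Nondegenerate) :
    ∃ (n : ℕ) (e : ((Fin n → AdeleRing (𝓞 F) F) × (Fin n → AdeleRing (𝓞 F) F)) ≃ₗ[AdeleRing (𝓞 F) F]
        AdelicSpace F V),
      ∀ c c' : (Fin n → AdeleRing (𝓞 F) F) × (Fin n → AdeleRing (𝓞 F) F),
        adelicTraceForm F E V Φ (e c) (e c') = c.1 ⬝ᵥ c'.2 - c'.1 ⬝ᵥ c.2 :=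
  exists_baseChange_darboux _ hφa hφ _

variable {n : ℕ}
  {e : ((Fin n → AdeleRing (𝓞 F) F) × (Fin n → AdeleRing (𝓞 F) F)) ≃ₗ[AdeleRing (𝓞 F) F] AdelicSpace F V}
  (he : ∀ c c' : (Fin n → AdeleRing (𝓞 F) F) × (Fin n → AdeleRing (𝓞 F) F),
    adelicTraceForm F E V Φ (e c) (e c') = c.1 ⬝ᵥ c'.2 - c'.1 ⬝ᵥ c.2)

include he in
/-- `heisForm = ½ φ_𝐀` in Darboux coordinates: `heisForm(e c, e c') = ½ (x · y' − x' · y)`.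
[cite: GelbartRogawski1991, §3.1 p. 454 L17–19] -/
theorem heisForm_coord (c c' : (Fin n → AdeleRing (𝓞 F) F) × (Fin n → AdeleRing (𝓞 F) F)) :
    heisForm F E V Φ (e c) (e c') = ⅟(2 : AdeleRing (𝓞 F) F) * (c.1 ⬝ᵥ c'.2 - c'.1 ⬝ᵥ c.2) := by
  rw [heisForm, LinearMap.smul_apply, LinearMap.smul_apply, he, smul_eq_mul]

/-! ## §2 The archimedean coordinates -/

/-- additivity helper: a dot product of vectors pushed forward along a non-unital ring homomorphism.
[cite: Weil1964, Chap. I n° 3–4] -/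
theorem dotProduct_map_map {R S : Type*} [NonUnitalNonAssocSemiring R] [NonUnitalNonAssocSemiring S]
    {G : Type*} [FunLike G R S] [NonUnitalRingHomClass G R S] (g : G) {m : Type*} [Fintype m] (x y : m → R) :
    (fun i => g (x i)) ⬝ᵥ (fun i => g (y i)) = g (x ⬝ᵥ y) := by
  simp only [dotProduct, map_sum, map_mul]

/-- orthogonality helper: `(a, 0) · (0, b) = 0` in `𝐀 = F_∞ × 𝐀_F^∞`. [cite: Weil1964, Chap. III n° 37] -/
theorem infiniteAdeleInl_mul_finiteAdeleInr (a : InfiniteAdeleRing F) (b : FiniteAdeleRing (𝓞 F) F) :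
    infiniteAdeleInl F a * finiteAdeleInr F b = 0 :=
  Prod.ext (mul_zero a) (zero_mul b)

/-- orthogonality helper: `(0, b) · (a, 0) = 0` in `𝐀`. [cite: Weil1964, Chap. III n° 37] -/
theorem finiteAdeleInr_mul_infiniteAdeleInl (a : InfiniteAdeleRing F) (b : FiniteAdeleRing (𝓞 F) F) :
    finiteAdeleInr F b * infiniteAdeleInl F a = 0 :=
  Prod.ext (zero_mul a) (mul_zero b)

/-- a dot product of archimedean coordinate vectors: `Σ (x_i, 0)(y_i, 0) = (x · y, 0)`. [cite: Weil1964, Chap. III n° 37] -/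
theorem dotProduct_arch (x y : Fin n → mixedSpace F) :
    (fun i => infiniteAdeleInl F ((ringEquiv_mixedSpace F).symm (x i))) ⬝ᵥ
        (fun i => infiniteAdeleInl F ((ringEquiv_mixedSpace F).symm (y i))) =
      infiniteAdeleInl F ((ringEquiv_mixedSpace F).symm (x ⬝ᵥ y)) := by
  simp only [dotProduct, map_sum, map_mul]

include he in
/-- **the archimedean part of `heisForm` in coordinates**: on the vectors
`J_∞(x, y) = (2 (x_i, 0)_i, (y_i, 0)_i)` (`x_i, y_i ∈ ℝ^{r₁} × ℂ^{r₂} ≅ F_∞`), `heisForm` is the standard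
alternating form `x · y' − x' · y` pushed forward by `t ↦ (t, 0)`: the compatibility `hjk` of `Heisenberg.map` for
the inclusion `H(W_∞) → H_𝐀(W)`. [cite: GelbartRogawski1991, §3.1 p. 454 L17–21] -/
theorem heisForm_coord_arch (v w : (Fin n → mixedSpace F) × (Fin n → mixedSpace F)) :
    heisForm F E V Φ
        (e (fun i => 2 * infiniteAdeleInl F ((ringEquiv_mixedSpace F).symm (v.1 i)),
          fun i => infiniteAdeleInl F ((ringEquiv_mixedSpace F).symm (v.2 i))))
        (e (fun i => 2 * infiniteAdeleInl F ((ringEquiv_mixedSpace F).symm (w.1 i)),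
          fun i => infiniteAdeleInl F ((ringEquiv_mixedSpace F).symm (w.2 i)))) =
      infiniteAdeleInl F ((ringEquiv_mixedSpace F).symm
        (altPolar (Matrix.toLinearMap₂' (mixedSpace F) (1 : Matrix (Fin n) (Fin n) (mixedSpace F))) v w)) := by
  rw [heisForm_coord he]
  dsimp only
  rw [show (fun i => 2 * infiniteAdeleInl F ((ringEquiv_mixedSpace F).symm (v.1 i))) =
      (2 : AdeleRing (𝓞 F) F) • fun i => infiniteAdeleInl F ((ringEquiv_mixedSpace F).symm (v.1 i)) from rfl,
    show (fun i => 2 * infiniteAdeleInl F ((ringEquiv_mixedSpace F).symm (w.1 i))) =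
      (2 : AdeleRing (𝓞 F) F) • fun i => infiniteAdeleInl F ((ringEquiv_mixedSpace F).symm (w.1 i)) from rfl,
    smul_dotProduct, smul_dotProduct, dotProduct_arch, dotProduct_arch, smul_eq_mul, smul_eq_mul, ← mul_sub,
    ← map_sub, ← map_sub, ← mul_assoc, invOf_mul_self, one_mul, altPolar_apply, Matrix.toLinearMap₂'_apply',
    Matrix.toLinearMap₂'_apply', Matrix.one_mulVec, Matrix.one_mulVec]

/-! ## §3 The finite-adelic coordinates -/

/-- the second component of `⅟2 ∈ 𝐀` is `⅟2 ∈ 𝐀_F^∞`. [cite: Weil1964, Chap. III n° 37] -/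
theorem invOf_two_snd [Invertible (2 : FiniteAdeleRing (𝓞 F) F)] :
    (⅟(2 : AdeleRing (𝓞 F) F)).2 = ⅟(2 : FiniteAdeleRing (𝓞 F) F) := by
  symm
  apply invOf_eq_right_inv
  have h : ((2 : AdeleRing (𝓞 F) F) * ⅟(2 : AdeleRing (𝓞 F) F)).2 = 1 := by
    rw [mul_invOf_self]
    rfl
  exact h

include he in
/-- **the finite-adelic part of `heisForm` in coordinates**: on the vectors `J_f(x, y) = ((0, x_i)_i, (0, y_i)_i)`
(`x_i, y_i ∈ 𝐀_F^∞`), `heisForm` is `½ (x · y' − x' · y)` pushed forward by `t ↦ (0, t)`: the compatibility `hjk`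
of `Heisenberg.map` for the inclusion `H(W_fin) → H_𝐀(W)` (source law `½ altPolar`, which
`halfAltPolarEquiv` identifies with the polarised law). [cite: GelbartRogawski1991, §3.1 p. 454 L17–21] -/
theorem heisForm_coord_fin [Invertible (2 : FiniteAdeleRing (𝓞 F) F)]
    (v w : (Fin n → FiniteAdeleRing (𝓞 F) F) × (Fin n → FiniteAdeleRing (𝓞 F) F)) :
    heisForm F E V Φ
        (e (fun i => finiteAdeleInr F (v.1 i), fun i => finiteAdeleInr F (v.2 i)))
        (e (fun i => finiteAdeleInr F (w.1 i), fun i => finiteAdeleInr F (w.2 i))) =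
      finiteAdeleInr F (((⅟(2 : FiniteAdeleRing (𝓞 F) F)) •
        altPolar (Matrix.toLinearMap₂' (FiniteAdeleRing (𝓞 F) F)
          (1 : Matrix (Fin n) (Fin n) (FiniteAdeleRing (𝓞 F) F)))) v w) := by
  rw [heisForm_coord he, dotProduct_map_map (finiteAdeleInr F), dotProduct_map_map (finiteAdeleInr F), ← map_sub,
    LinearMap.smul_apply, LinearMap.smul_apply, altPolar_apply, Matrix.toLinearMap₂'_apply',
    Matrix.toLinearMap₂'_apply', Matrix.one_mulVec, Matrix.one_mulVec, smul_eq_mul]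
  refine Prod.ext ?_ ?_
  · exact mul_zero _
  · change (⅟(2 : AdeleRing (𝓞 F) F)).2 * _ = ⅟(2 : FiniteAdeleRing (𝓞 F) F) * _
    rw [invOf_two_snd]
    rfl

/-! ## §4 Orthogonality and generation -/

include he in
/-- **the archimedean and finite-adelic parts are `heisForm`-orthogonal** (`(a, 0) · (0, b) = 0` in `𝐀`): the
hypothesis `h₁₂` of `Heisenberg.map_mul_map_comm`. [cite: GelbartRogawski1991, §3.1 p. 454 L17–21] -/
theorem heisForm_coord_arch_fin (v : (Fin n → mixedSpace F) × (Fin n → mixedSpace F))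
    (w : (Fin n → FiniteAdeleRing (𝓞 F) F) × (Fin n → FiniteAdeleRing (𝓞 F) F)) :
    heisForm F E V Φ
        (e (fun i => 2 * infiniteAdeleInl F ((ringEquiv_mixedSpace F).symm (v.1 i)),
          fun i => infiniteAdeleInl F ((ringEquiv_mixedSpace F).symm (v.2 i))))
        (e (fun i => finiteAdeleInr F (w.1 i), fun i => finiteAdeleInr F (w.2 i))) = 0 := by
  rw [heisForm_coord he]
  simp only [dotProduct, mul_assoc, infiniteAdeleInl_mul_finiteAdeleInr, finiteAdeleInr_mul_infiniteAdeleInl,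
    mul_zero, Finset.sum_const_zero, sub_zero]

include he in
/-- the symmetric orthogonality `h₂₁`. [cite: GelbartRogawski1991, §3.1 p. 454 L17–21] -/
theorem heisForm_coord_fin_arch (v : (Fin n → mixedSpace F) × (Fin n → mixedSpace F))
    (w : (Fin n → FiniteAdeleRing (𝓞 F) F) × (Fin n → FiniteAdeleRing (𝓞 F) F)) :
    heisForm F E V Φ (e (fun i => finiteAdeleInr F (w.1 i), fun i => finiteAdeleInr F (w.2 i)))
        (e (fun i => 2 * infiniteAdeleInl F ((ringEquiv_mixedSpace F).symm (v.1 i)),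
          fun i => infiniteAdeleInl F ((ringEquiv_mixedSpace F).symm (v.2 i)))) = 0 := by
  rw [heisForm_coord he]
  simp only [dotProduct, mul_assoc, infiniteAdeleInl_mul_finiteAdeleInr, finiteAdeleInr_mul_infiniteAdeleInl,
    mul_zero, Finset.sum_const_zero, sub_zero]

/-- **`𝐀ⁿ × 𝐀ⁿ = J_∞(F_∞-part) + J_f(finite part)`**: every coordinate vector is the sum of an archimedean one and
a finite-adelic one (the hypothesis `hV` of `Heisenberg.exists_eq_map_mul_map`; the factor `2` on the first
archimedean block is undone by `⅟2 ∈ 𝐀`). [cite: Weil1964, Chap. III n° 37] -/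
theorem exists_eq_archCoord_add_finCoord (c : (Fin n → AdeleRing (𝓞 F) F) × (Fin n → AdeleRing (𝓞 F) F)) :
    ∃ (v : (Fin n → mixedSpace F) × (Fin n → mixedSpace F))
      (w : (Fin n → FiniteAdeleRing (𝓞 F) F) × (Fin n → FiniteAdeleRing (𝓞 F) F)),
      c = (fun i => 2 * infiniteAdeleInl F ((ringEquiv_mixedSpace F).symm (v.1 i)),
            fun i => infiniteAdeleInl F ((ringEquiv_mixedSpace F).symm (v.2 i))) +
          (fun i => finiteAdeleInr F (w.1 i), fun i => finiteAdeleInr F (w.2 i)) := by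
  refine ⟨(fun i => ringEquiv_mixedSpace F ((⅟(2 : AdeleRing (𝓞 F) F) * c.1 i).1),
    fun i => ringEquiv_mixedSpace F (c.2 i).1), (fun i => (c.1 i).2, fun i => (c.2 i).2), ?_⟩
  refine Prod.ext (funext fun i => ?_) (funext fun i => ?_)
  · change c.1 i = 2 * infiniteAdeleInl F ((ringEquiv_mixedSpace F).symm
        (ringEquiv_mixedSpace F ((⅟(2 : AdeleRing (𝓞 F) F) * c.1 i).1))) + finiteAdeleInr F (c.1 i).2
    rw [RingEquiv.symm_apply_apply]
    refine Prod.ext ?_ ?_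
    · change (c.1 i).1 = ((2 : AdeleRing (𝓞 F) F) * (⅟(2 : AdeleRing (𝓞 F) F) * c.1 i)).1 + 0
      rw [add_zero, mul_invOf_cancel_left]
    · change (c.1 i).2 = (2 : AdeleRing (𝓞 F) F).2 * 0 + (c.1 i).2
      rw [mul_zero, zero_add]
  · change c.2 i = infiniteAdeleInl F ((ringEquiv_mixedSpace F).symm (ringEquiv_mixedSpace F (c.2 i).1)) +
        finiteAdeleInr F (c.2 i).2
    rw [RingEquiv.symm_apply_apply]
    refine Prod.ext ?_ ?_
    · change (c.2 i).1 = (c.2 i).1 + 0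
      rw [add_zero]
    · change (c.2 i).2 = 0 + (c.2 i).2
      rw [zero_add]

/-- **`𝐀 = (F_∞, 0) + (0, 𝐀_F^∞)`** (the hypothesis `hR` of `Heisenberg.exists_eq_map_mul_map`).
[cite: Weil1964, Chap. III n° 37] -/
theorem exists_eq_inl_add_inr (t : AdeleRing (𝓞 F) F) :
    ∃ (t₁ : mixedSpace F) (t₂ : FiniteAdeleRing (𝓞 F) F),
      t = infiniteAdeleInl F ((ringEquiv_mixedSpace F).symm t₁) + finiteAdeleInr F t₂ := by
  refine ⟨ringEquiv_mixedSpace F t.1, t.2, ?_⟩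
  rw [RingEquiv.symm_apply_apply]
  exact Prod.ext (by change t.1 = t.1 + 0; rw [add_zero]) (by change t.2 = 0 + t.2; rw [zero_add])

/-! ## §5 Continuity -/

/-- **Darboux coordinates are continuous** for the adelic (module) topology of `W_𝐀` (rendering R8 of
`Prop311AsPrinted`): any `𝐀`-linear map out of `𝐀ⁿ × 𝐀ⁿ` is. [cite: GelbartRogawski1991, Prop. 3.1.1 p. 455 L1–2] -/
theorem continuous_coord : @Continuous _ _ _ (adelicSpaceTopology F V) e := by
  letI : TopologicalSpace (AdelicSpace F V) := adelicSpaceTopology F V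
  haveI : IsModuleTopology (AdeleRing (𝓞 F) F) (AdelicSpace F V) := ⟨rfl⟩
  haveI : ContinuousAdd (AdelicSpace F V) := IsModuleTopology.toContinuousAdd (AdeleRing (𝓞 F) F) (AdelicSpace F V)
  exact IsModuleTopology.continuous_of_linearMap e.toLinearMap

/-- **the archimedean coordinates `J_∞` are continuous**. [cite: GelbartRogawski1991, Prop. 3.1.1 p. 455 L1–2] -/
theorem continuous_archCoord :
    Continuous fun v : (Fin n → mixedSpace F) × (Fin n → mixedSpace F) =>
      ((fun i => 2 * infiniteAdeleInl F ((ringEquiv_mixedSpace F).symm (v.1 i)),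
        fun i => infiniteAdeleInl F ((ringEquiv_mixedSpace F).symm (v.2 i))) :
        (Fin n → AdeleRing (𝓞 F) F) × (Fin n → AdeleRing (𝓞 F) F)) := by
  have hθ : Continuous fun t : mixedSpace F => infiniteAdeleInl F ((ringEquiv_mixedSpace F).symm t) :=
    (continuous_infiniteAdeleInl F).comp (continuous_ringEquiv_mixedSpace_symm F)
  refine Continuous.prodMk (continuous_pi fun i => continuous_const.mul (hθ.comp ?_))
    (continuous_pi fun i => hθ.comp ?_)
  · exact (continuous_apply i).comp continuous_fst
  · exact (continuous_apply i).comp continuous_snd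

/-- **the finite-adelic coordinates `J_f` are continuous**. [cite: GelbartRogawski1991, Prop. 3.1.1 p. 455 L1–2] -/
theorem continuous_finCoord :
    Continuous fun w : (Fin n → FiniteAdeleRing (𝓞 F) F) × (Fin n → FiniteAdeleRing (𝓞 F) F) =>
      ((fun i => finiteAdeleInr F (w.1 i), fun i => finiteAdeleInr F (w.2 i)) :
        (Fin n → AdeleRing (𝓞 F) F) × (Fin n → AdeleRing (𝓞 F) F)) := by
  refine Continuous.prodMk (continuous_pi fun i => (continuous_finiteAdeleInr F).comp ?_)
    (continuous_pi fun i => (continuous_finiteAdeleInr F).comp ?_)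
  · exact (continuous_apply i).comp continuous_fst
  · exact (continuous_apply i).comp continuous_snd

/-- continuity of a map into a Heisenberg group for the topology induced by the two projections (the shape of
`heisenbergTopology`): it suffices that both components are continuous. [cite: GelbartRogawski1991, §3.1 p. 454 L20] -/
theorem continuous_heisenberg_mk {R W X : Type*} [CommRing R] [AddCommGroup W] [Module R W] (B : W →ₗ[R] W →ₗ[R] R)
    (tW : TopologicalSpace W) (tR : TopologicalSpace R) [TopologicalSpace X] {f : X → W} {g : X → R}
    (hf : Continuous f) (hg : Continuous g) :
    @Continuous X (Heisenberg B) _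
      (TopologicalSpace.induced (fun h => h.v) tW ⊓ TopologicalSpace.induced (fun h => h.t) tR)
      fun x => ⟨f x, g x⟩ :=
  continuous_inf_rng.2 ⟨continuous_induced_rng.2 hf, continuous_induced_rng.2 hg⟩

/-- the vector component `h ↦ h.v` is continuous for that topology. [cite: GelbartRogawski1991, §3.1 p. 454 L20] -/
theorem continuous_heisenberg_v {R W : Type*} [CommRing R] [AddCommGroup W] [Module R W] (B : W →ₗ[R] W →ₗ[R] R)
    (tW : TopologicalSpace W) (tR : TopologicalSpace R) :
    @Continuous (Heisenberg B) W
      (TopologicalSpace.induced (fun h => h.v) tW ⊓ TopologicalSpace.induced (fun h => h.t) tR) tW fun h => h.v :=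
  continuous_inf_dom_left (t₂ := TopologicalSpace.induced (fun h : Heisenberg B => h.t) tR) continuous_induced_dom

/-- the central component `h ↦ h.t` is continuous for that topology. [cite: GelbartRogawski1991, §3.1 p. 454 L20] -/
theorem continuous_heisenberg_t {R W : Type*} [CommRing R] [AddCommGroup W] [Module R W] (B : W →ₗ[R] W →ₗ[R] R)
    (tW : TopologicalSpace W) (tR : TopologicalSpace R) :
    @Continuous (Heisenberg B) R
      (TopologicalSpace.induced (fun h => h.v) tW ⊓ TopologicalSpace.induced (fun h => h.t) tR) tR fun h => h.t :=
  continuous_inf_dom_right (t₁ := TopologicalSpace.induced (fun h : Heisenberg B => h.v) tW) continuous_induced_dom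

end Prop311

end Literature.NumberTheory.GelbartRogawski1991

end
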